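import Literature.AlgebraicGeometry.Resolution.MonomialOrderReductionUnit
import Literature.AlgebraicGeometry.Resolution.MarkedIdealsRestrict
import HarnessLib

/-!
# Resolutions of marked ideals depend on the boundary only through the divisors through each point (BGMW 2011, Defs. 3.1.1–3.1.3; Kollár 2007, Def. 3.24–3.25)

Topic: `Literature/AlgebraicGeometry/Resolution`. In Bierstone–Grigoriev–Milman–Włodarczyk,
arXiv:1206.3090, Def. 3.1.1, the boundary `E` of a marked ideal `(X, 𝓘, E, μ)` is a SET of
smooth divisors having simple normal crossings, and the conditions of Def. 3.1.3 on a multiple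
blow-up ((1) `C_i ⊂ supp(𝓘_i, μ)`, (2) `C_i` has simple normal crossings with `E_i`, (4) `E_{i+1}`
= strict transforms plus the exceptional divisor) are conditions at the points of `X_i`
(Kollár 2007, Def. 3.24: local coordinates at each point adapted to the divisors THROUGH it). The
tree renders `E` as a LIST of ideal sheaves (`MarkedIdeal.boundary`, `HasSNCWith`,
`MarkedIdeal.transform`, `CentreSeq.IsAdmissibleFor` / `IsResolutionOf`; `MarkedIdeals.lean`,
`BlowupSequences.lean`), which carries inessential information: the order of the list, repeated
or empty members, and how a divisor with several connected components is listed (as one member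
or as several). This file PROVES that the notions "`s` is a multiple blow-up of / a resolution of
`(X, 𝓘, E, μ)`" are insensitive to all of it:

* `BoundaryEquiv B₁ B₂` — **pointwise equivalence of boundaries**: through every point `x` the
  two lists have the same divisors, in the sense that every member of either list through `x`
  has the same stalk at `x` as some member of the other through `x`, and in each list distinct
  members through `x` have distinct stalks (automatic under `HasSNCWith`,
  `HasSNCWith.injOn_stalkIdeal`); an equivalence relation on such lists (`symm`, `trans`,
  `HasSNCWith.boundaryEquiv_refl`); examples: permutations (`boundaryEquiv_of_perm`), removing
  empty members (`boundaryEquiv_filter_ne_top`), removing repetitions (`boundaryEquiv_dedup`),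
  and any two lists with the same members (`boundaryEquiv_of_forall_mem_iff`);
* `HasSNCWith.of_boundaryEquiv` — simple normal crossings (with a centre) transfer;
* `BoundaryEquiv.transform` — **equivalence persists under a blow-up** along a centre having
  simple normal crossings with the boundaries: the transformed boundaries
  `Bᵢ.map (strict transform) ++ [exceptional]` are again equivalent — the stalk of a strict
  transform at `x'` depends only on the stalk of the divisor at `π x'`
  (`stalkIdeal_strictTransformIdeal_congr`), and distinct divisors through `π x'` keep distinct,
  non-exceptional stalks at `x'` (`stalkIdeal_eq_of_stalkIdeal_strictTransformIdeal_eq`,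
  `stalkIdeal_strictTransformIdeal_ne_stalkIdeal_comap`: the chart analysis of `BlowupSNC.lean`
  over the centre — generalizing the stratum case of `MonomialMarkedIdealsBlowup.lean` to an
  arbitrary admissible centre — and the invertible stalk maps off it);
* **`CentreSeq.IsAdmissibleFor.of_boundaryEquiv`, `CentreSeq.IsResolutionOf.of_boundaryEquiv`**
  — a blow-up sequence that is a multiple blow-up (resp. a resolution) of `(X, 𝓘, B₁, μ)` is one
  of `(X, 𝓘, B₂, μ)` for every equivalent boundary `B₂`; in particular for permuted, pruned or
  de-duplicated boundaries (`IsResolutionOf.of_perm`, `.filter_ne_top`, `.dedup`).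

## Sources

* E. Bierstone, D. Grigoriev, P. Milman, J. Włodarczyk, arXiv:1206.3090, Defs. 3.1.1–3.1.4
  (p. 6). [BierstoneGrigorievMilmanWlodarczyk2011]
* J. Kollár, *Lectures on Resolution of Singularities* (2007), Def. 3.24–3.25 (pp. 125–126 of
  the held copy). [Kollar2007]
* The Stacks Project, Tag 0804 (charts of a blowing up), Tag 02OS. [StacksProject]
-/

noncomputable section

open CategoryTheory AlgebraicGeometry TopologicalSpace IsLocalRing

namespace Literature.AlgebraicGeometry.Resolution

universe u

/-! ## Pointwise equivalence of boundaries -/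

section Equiv

variable {X : Scheme.{u}}

/-- In the list `B`, distinct members through `x` have distinct stalks at `x`. [folklore] -/
def StalkInjectiveAt (B : List X.IdealSheafData) (x : X) : Prop :=
  ∀ D ∈ B, ∀ D' ∈ B, x ∈ D.support → x ∈ D'.support → stalkIdeal D x = stalkIdeal D' x → D = D'

/-- **Pointwise equivalence of boundaries**: through every point the two lists have the same
divisors — matching stalks both ways — and each list is stalk-injective there.
[cite: BierstoneGrigorievMilmanWlodarczyk2011, Def. 3.1.1] -/
def BoundaryEquiv (B₁ B₂ : List X.IdealSheafData) : Prop :=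
  ∀ x : X,
    (∀ D₁ ∈ B₁, x ∈ D₁.support → ∃ D₂ ∈ B₂, x ∈ D₂.support ∧ stalkIdeal D₂ x = stalkIdeal D₁ x) ∧
    (∀ D₂ ∈ B₂, x ∈ D₂.support → ∃ D₁ ∈ B₁, x ∈ D₁.support ∧ stalkIdeal D₁ x = stalkIdeal D₂ x) ∧
    StalkInjectiveAt B₁ x ∧ StalkInjectiveAt B₂ x

namespace BoundaryEquiv

variable {B₁ B₂ B₃ : List X.IdealSheafData}

/-- Symmetry. [folklore] -/
theorem symm (h : BoundaryEquiv B₁ B₂) : BoundaryEquiv B₂ B₁ := fun x =>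
  ⟨(h x).2.1, (h x).1, (h x).2.2.2, (h x).2.2.1⟩

/-- Transitivity. [folklore] -/
theorem trans (h : BoundaryEquiv B₁ B₂) (h' : BoundaryEquiv B₂ B₃) : BoundaryEquiv B₁ B₃ := by
  intro x
  obtain ⟨hf, hb, hi₁, -⟩ := h x
  obtain ⟨hf', hb', -, hi₃⟩ := h' x
  refine ⟨fun D₁ hD₁ hx => ?_, fun D₃ hD₃ hx => ?_, hi₁, hi₃⟩
  · obtain ⟨D₂, hD₂, hx₂, h₂⟩ := hf D₁ hD₁ hx
    obtain ⟨D₃, hD₃, hx₃, h₃⟩ := hf' D₂ hD₂ hx₂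
    exact ⟨D₃, hD₃, hx₃, h₃.trans h₂⟩
  · obtain ⟨D₂, hD₂, hx₂, h₂⟩ := hb' D₃ hD₃ hx
    obtain ⟨D₁, hD₁, hx₁, h₁⟩ := hb D₂ hD₂ hx₂
    exact ⟨D₁, hD₁, hx₁, h₁.trans h₂⟩

end BoundaryEquiv

/-- Two lists with the same members are equivalent as soon as one is stalk-injective. [folklore] -/
theorem boundaryEquiv_of_forall_mem_iff {B₁ B₂ : List X.IdealSheafData} (h : ∀ D, D ∈ B₁ ↔ D ∈ B₂)
    (hinj : ∀ x, StalkInjectiveAt B₁ x) : BoundaryEquiv B₁ B₂ := fun x =>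
  ⟨fun D hD hx => ⟨D, (h D).mp hD, hx, rfl⟩, fun D hD hx => ⟨D, (h D).mpr hD, hx, rfl⟩, hinj x,
    fun D hD D' hD' => hinj x D ((h D).mpr hD) D' ((h D').mpr hD')⟩

/-- **Permuted boundaries are equivalent.** [folklore] -/
theorem boundaryEquiv_of_perm {B₁ B₂ : List X.IdealSheafData} (h : B₁.Perm B₂)
    (hinj : ∀ x, StalkInjectiveAt B₁ x) : BoundaryEquiv B₁ B₂ :=
  boundaryEquiv_of_forall_mem_iff (fun _ => h.mem_iff) hinj

/-- **Removing repeated members gives an equivalent boundary.** [folklore] -/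
theorem boundaryEquiv_dedup [DecidableEq X.IdealSheafData] {B : List X.IdealSheafData}
    (hinj : ∀ x, StalkInjectiveAt B x) : BoundaryEquiv B B.dedup :=
  boundaryEquiv_of_forall_mem_iff (fun _ => List.mem_dedup.symm) hinj

/-- **Removing empty members (`⊤`) gives an equivalent boundary.** [folklore] -/
theorem boundaryEquiv_filter_ne_top [DecidableEq X.IdealSheafData] {B : List X.IdealSheafData}
    (hinj : ∀ x, StalkInjectiveAt B x) : BoundaryEquiv B (B.filter fun D => D ≠ ⊤) := by
  intro x
  refine ⟨fun D hD hx => ⟨D, ?_, hx, rfl⟩, fun D hD hx => ⟨D, (List.mem_filter.mp hD).1, hx, rfl⟩,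
    hinj x, fun D hD D' hD' => hinj x D (List.mem_filter.mp hD).1 D' (List.mem_filter.mp hD').1⟩
  refine List.mem_filter.mpr ⟨hD, decide_eq_true fun htop => ?_⟩
  rw [htop, Scheme.IdealSheafData.support_top] at hx
  exact hx

/-- Under `HasSNCWith`, distinct members through a point have distinct stalks (they are
generated by non-associated members of one regular system of parameters). [folklore] -/
theorem HasSNCWith.injOn_stalkIdeal {B : List X.IdealSheafData} {C : X.IdealSheafData}
    (h : HasSNCWith B C) (x : X) : StalkInjectiveAt B x := by
  intro D hD D' hD' hx hx' heq
  obtain ⟨hreg, u, hu, ⟨ι, hιinj, hι⟩, -⟩ := h x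
  haveI := hreg
  haveI := isDomain_of_isRegularLocalRing (X.presheaf.stalk x)
  have hrsop : IsRsopPart (u ∘ id) := isRsopPart_comp_of_rsop rfl u hu id Function.injective_id
  by_contra hne
  rw [hι ⟨D, hD, hx⟩, hι ⟨D', hD', hx'⟩, Ideal.span_singleton_eq_span_singleton] at heq
  exact hrsop.not_associated (i := ι ⟨D, hD, hx⟩) (j := ι ⟨D', hD', hx'⟩)
    (fun h => hne (congrArg Subtype.val (hιinj h))) heq

/-- Reflexivity for boundaries with simple normal crossings. [folklore] -/
theorem HasSNCWith.boundaryEquiv_refl {B : List X.IdealSheafData} {C : X.IdealSheafData}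
    (h : HasSNCWith B C) : BoundaryEquiv B B :=
  boundaryEquiv_of_forall_mem_iff (fun _ => Iff.rfl) h.injOn_stalkIdeal

/-- **Simple normal crossings transfer along an equivalence of boundaries** (the regular system
of parameters at `x` serves both lists; the labels are transported through matching stalks).
[cite: BierstoneGrigorievMilmanWlodarczyk2011, Def. 3.1.1 and Def. 3.1.3 (2)] -/
theorem HasSNCWith.of_boundaryEquiv {B₁ B₂ : List X.IdealSheafData} {C : X.IdealSheafData}
    (he : BoundaryEquiv B₁ B₂) (h : HasSNCWith B₁ C) : HasSNCWith B₂ C := by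
  classical
  intro x
  obtain ⟨hreg, u, hu, ⟨ι, hιinj, hι⟩, hC⟩ := h x
  obtain ⟨-, hback, -, hinj₂⟩ := he x
  -- the member of `B₁` matching a member of `B₂` through `x`
  have hpre := fun D : {D : X.IdealSheafData // D ∈ B₂ ∧ x ∈ D.support} => hback D.1 D.2.1 D.2.2
  let pre : {D : X.IdealSheafData // D ∈ B₂ ∧ x ∈ D.support} →
      {D : X.IdealSheafData // D ∈ B₁ ∧ x ∈ D.support} := fun D =>
    ⟨(hpre D).choose, (hpre D).choose_spec.1, (hpre D).choose_spec.2.1⟩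
  have hpre_stalk : ∀ D, stalkIdeal (pre D).1 x = stalkIdeal D.1 x := fun D =>
    (hpre D).choose_spec.2.2
  refine ⟨hreg, u, hu, ⟨ι ∘ pre, ?_, fun D => ?_⟩, hC⟩
  · intro D D' hDD'
    have h1 : pre D = pre D' := hιinj hDD'
    apply Subtype.ext
    refine hinj₂ D.1 D.2.1 D'.1 D'.2.1 D.2.2 D'.2.2 ?_
    rw [← hpre_stalk D, ← hpre_stalk D', h1]
  · rw [Function.comp_apply, ← hι (pre D), hpre_stalk D]

end Equiv

/-! ## Strict transforms at a point: dependence on the stalk below, injectivity -/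

section Strict

variable {X X' : Scheme.{u}} [IsLocallyNoetherian X] {π : X' ⟶ X} {C : X.IdealSheafData}
  {Es : List X.IdealSheafData}

omit [IsLocallyNoetherian X] in
/-- **The stalk of a strict transform at `x'` depends only on the stalk of the divisor at
`π x'`.** [folklore] -/
theorem stalkIdeal_strictTransformIdeal_congr [IsLocallyNoetherian X'] {D₁ D₂ : X.IdealSheafData}
    {x' : X'} (h : stalkIdeal D₁ (π x') = stalkIdeal D₂ (π x')) :
    stalkIdeal (strictTransformIdeal π C D₁) x' = stalkIdeal (strictTransformIdeal π C D₂) x' := by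
  rw [stalkIdeal_strictTransformIdeal, stalkIdeal_strictTransformIdeal, h]

/-- The coding of the labels of `ChartData.exists_rsop` back to the labels of the old divisors.
[folklore] -/
private def code' {x' : X'} (D : ChartData π C x') : Fin D.a ⊕ D.GoodGen → Fin D.r ⊕ Fin D.a :=
  Sum.elim (fun m => Sum.inr m) (fun j => Sum.inl j.1)

/-- **The stalks of the strict transforms at a point over an admissible centre** (the chart
analysis of `BlowupSNC.lean`): for an old divisor `K` through `π x'`, the stalk of `K'` at `x'`
is either trivial or generated by the member of the regular system of parameters of `𝒪_{X',x'}`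
coded by the label of `K`; the exceptional stalk is generated by the member with no code.
[cite: Kollar2007, Def. 3.25] -/
private theorem stalkIdeal_strictTransformIdeal_cases' (hEs : HasSNCWith Es C) (hπ : IsBlowup π C)
    {x' : X'} (hxC : π x' ∈ C.support) :
    ∃ (D : ChartData π C x') (τ : {K : X.IdealSheafData // K ∈ Es ∧ π x' ∈ K.support} →
        Fin D.r ⊕ Fin D.a) (d : ℕ) (v : Fin d → X'.presheaf.stalk x')
        (lab : Option (Fin D.a ⊕ D.GoodGen) → Fin d),
      Function.Injective τ ∧ IsRsopPart v ∧ Function.Injective lab ∧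
      stalkIdeal (C.comap π) x' = Ideal.span {v (lab none)} ∧
      ∀ K, stalkIdeal (strictTransformIdeal π C K.1) x' = ⊤ ∨
        ∃ l, code' D l = τ K ∧ stalkIdeal (strictTransformIdeal π C K.1) x' =
          Ideal.span {v (lab (some l))} := by
  haveI : IsProper π := hπ.isProper
  haveI : IsLocallyNoetherian X' := LocallyOfFiniteType.isLocallyNoetherian π
  obtain ⟨D, τ, hτinj, hτ⟩ := exists_chartData hπ hEs x' hxC
  obtain ⟨hregS, d, v, hsf, hspan, lab, hlabinj, hv0, hvw, hve⟩ := D.exists_rsop hxC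
  haveI := hregS
  have hrsop : IsRsopPart (v ∘ id) := isRsopPart_comp_of_rsop hsf v hspan id Function.injective_id
  refine ⟨D, τ, d, v, lab, hτinj, hrsop, hlabinj, by rw [hv0]; exact D.stalkIdeal_exceptional hxC,
    fun K => ?_⟩
  letI := D.algB
  rcases hl : τ K with j | m
  · have hKx : stalkIdeal K.1 (π x') = Ideal.span {(X.presheaf.germ D.U (π x') D.hxU).hom (D.x j)} := by
      rw [hτ K, hl, Sum.elim_inl]
    by_cases hji : j = D.i
    · subst hji
      exact Or.inl (D.stalkIdeal_strictTransform_x_self hxC K.1 hKx)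
    · have hst := D.stalkIdeal_strictTransform_x hxC K.1 hji hKx
      by_cases hQ : D.gen j ∈ D.Q
      · refine Or.inr ⟨Sum.inr ⟨j, hji, hQ⟩, rfl, ?_⟩
        rw [hst, hve]
      · left
        rw [hst, Ideal.span_singleton_eq_top]
        by_contra hu
        exact hQ ((D.chartGen_mem_Q_iff j).mpr ((mem_maximalIdeal _).mpr hu))
  · have hKx : stalkIdeal K.1 (π x') = Ideal.span {(X.presheaf.germ D.U (π x') D.hxU).hom (D.w m)} := by
      rw [hτ K, hl, Sum.elim_inr]
    refine Or.inr ⟨Sum.inl m, rfl, ?_⟩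
    rw [D.stalkIdeal_strictTransform_w hxC K.1 m hKx, hvw]

omit [IsLocallyNoetherian X] in
/-- The coding is injective. [folklore] -/
private theorem code'_injective {x' : X'} (D : ChartData π C x') : Function.Injective (code' D) := by
  rintro (m | j) (m' | j') h
  · simp only [code', Sum.elim_inl, Sum.inr.injEq] at h; rw [h]
  · simp [code'] at h
  · simp [code'] at h
  · simp only [code', Sum.elim_inr, Sum.inl.injEq] at h; rw [Subtype.ext h]

/-- **The stalk of a non-trivial strict transform is never the exceptional stalk.**
[cite: Kollar2007, Def. 3.25] -/
theorem stalkIdeal_strictTransformIdeal_ne_stalkIdeal_comap (hEs : HasSNCWith Es C) (hπ : IsBlowup π C)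
    {K : X.IdealSheafData} (hK : K ∈ Es) {x' : X'} (hx' : x' ∈ (C.comap π).support)
    (hxK : x' ∈ (strictTransformIdeal π C K).support) :
    stalkIdeal (strictTransformIdeal π C K) x' ≠ stalkIdeal (C.comap π) x' := by
  haveI : IsProper π := hπ.isProper
  haveI : IsLocallyNoetherian X' := LocallyOfFiniteType.isLocallyNoetherian π
  have hxC : π x' ∈ C.support := by
    have h : x' ∈ ((C.comap π).support : Set X') := hx'
    rwa [Scheme.IdealSheafData.support_comap] at h
  have hx : π x' ∈ K.support := mem_support_of_mem_support_strictTransformIdeal hxK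
  have hle := (mem_support_iff_stalkIdeal_le _ _).mp hxK
  have hne : stalkIdeal (strictTransformIdeal π C K) x' ≠ ⊤ := fun h =>
    (maximalIdeal.isMaximal _).ne_top (top_le_iff.mp (h ▸ hle))
  obtain ⟨D, τ, d, v, lab, -, hrsop, hlabinj, hF, hcases⟩ := stalkIdeal_strictTransformIdeal_cases' hEs hπ hxC
  haveI := hrsop.isRegularLocalRing
  haveI := isDomain_of_isRegularLocalRing (X'.presheaf.stalk x')
  intro heq
  rcases hcases ⟨K, hK, hx⟩ with htop | ⟨l, -, hl⟩
  · exact hne htop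
  · rw [heq, hF, Ideal.span_singleton_eq_span_singleton] at hl
    exact hrsop.not_associated (fun h => by cases hlabinj h) hl

/-- **Distinct stalks below give distinct stalks of the strict transforms** (wherever one of them
is non-trivial): if `K₁, K₂ ∈ Es` pass through `π x'`, `x'` lies on `K₁'`, and `K₁'`, `K₂'` have
the same stalk at `x'`, then `K₁`, `K₂` have the same stalk at `π x'` — over the centre by the
chart labels, off the centre because the stalk map is an isomorphism. (Generalizes, to an
arbitrary admissible centre, the stratum case `eq_of_strictTransformIdeal_eq` of
`MonomialMarkedIdealsBlowup.lean`.) [cite: Kollar2007, Def. 3.25] -/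
theorem stalkIdeal_eq_of_stalkIdeal_strictTransformIdeal_eq (hEs : HasSNCWith Es C) (hπ : IsBlowup π C)
    {K₁ K₂ : X.IdealSheafData} (h₁ : K₁ ∈ Es) (h₂ : K₂ ∈ Es) {x' : X'}
    (hx' : x' ∈ (strictTransformIdeal π C K₁).support) (hx₂ : π x' ∈ K₂.support)
    (heq : stalkIdeal (strictTransformIdeal π C K₁) x' = stalkIdeal (strictTransformIdeal π C K₂) x') :
    stalkIdeal K₁ (π x') = stalkIdeal K₂ (π x') := by
  haveI : IsProper π := hπ.isProper
  haveI : IsLocallyNoetherian X' := LocallyOfFiniteType.isLocallyNoetherian π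
  have hx₁ : π x' ∈ K₁.support := mem_support_of_mem_support_strictTransformIdeal hx'
  have hle₁ := (mem_support_iff_stalkIdeal_le _ _).mp hx'
  have hne₁ : stalkIdeal (strictTransformIdeal π C K₁) x' ≠ ⊤ := fun h =>
    (maximalIdeal.isMaximal _).ne_top (top_le_iff.mp (h ▸ hle₁))
  by_cases hxC : π x' ∈ C.support
  · obtain ⟨D, τ, d, v, lab, hτinj, hrsop, hlabinj, -, hcases⟩ := stalkIdeal_strictTransformIdeal_cases' hEs hπ hxC
    haveI := hrsop.isRegularLocalRing
    haveI := isDomain_of_isRegularLocalRing (X'.presheaf.stalk x')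
    rcases hcases ⟨K₁, h₁, hx₁⟩ with htop | ⟨l₁, hc₁, hl₁⟩
    · exact absurd htop hne₁
    rcases hcases ⟨K₂, h₂, hx₂⟩ with htop | ⟨l₂, hc₂, hl₂⟩
    · exact absurd (heq ▸ htop) hne₁
    have hll : l₁ = l₂ := by
      by_contra hne
      rw [heq, hl₂, Ideal.span_singleton_eq_span_singleton] at hl₁
      exact hrsop.not_associated (fun h => hne (Option.some_injective _ (hlabinj h)).symm) hl₁
    subst hll
    have hK : (⟨K₁, h₁, hx₁⟩ : {K : X.IdealSheafData // K ∈ Es ∧ π x' ∈ K.support}) = ⟨K₂, h₂, hx₂⟩ :=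
      hτinj (hc₁.symm.trans hc₂)
    have hK' : K₁ = K₂ := by simpa using congrArg Subtype.val hK
    rw [hK']
  · haveI := hπ.isIso_stalkMap_of_not_mem_support hxC
    let ε : X.presheaf.stalk (π x') ≃+* X'.presheaf.stalk x' :=
      (asIso (π.stalkMap x')).commRingCatIsoToRingEquiv
    have hε : (ε : X.presheaf.stalk (π x') →+* X'.presheaf.stalk x') = (π.stalkMap x').hom := rfl
    have hs₁ := stalkIdeal_strictTransformIdeal_of_not_mem_support (π := π) C K₁ hxC
    have hs₂ := stalkIdeal_strictTransformIdeal_of_not_mem_support (π := π) C K₂ hxC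
    have hmap : (stalkIdeal K₁ (π x')).map (ε : X.presheaf.stalk (π x') →+* X'.presheaf.stalk x') =
        (stalkIdeal K₂ (π x')).map (ε : X.presheaf.stalk (π x') →+* X'.presheaf.stalk x') := by
      rw [hε, ← hs₁, ← hs₂, heq]
    have h := congrArg (Ideal.map (ε.symm : X'.presheaf.stalk x' →+* X.presheaf.stalk (π x'))) hmap
    rwa [Ideal.map_of_equiv, Ideal.map_of_equiv] at h

end Strict

/-! ## Equivalence persists under a blow-up -/

section Transform

variable {X X' : Scheme.{u}} [IsLocallyNoetherian X] {π : X' ⟶ X} {C : X.IdealSheafData}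

omit [IsLocallyNoetherian X] in
/-- A member of a transformed boundary through `x'` is either the exceptional divisor or the
strict transform of a member through `π x'`. [folklore] -/
theorem mem_transform_boundary_cases {B : List X.IdealSheafData} {D' : X'.IdealSheafData} {x' : X'}
    (hD' : D' ∈ B.map (strictTransformIdeal π C) ++ [C.comap π]) (hx' : x' ∈ D'.support) :
    D' = C.comap π ∨ ∃ D ∈ B, π x' ∈ D.support ∧ strictTransformIdeal π C D = D' := by
  rcases List.mem_append.mp hD' with h | h
  · obtain ⟨D, hD, rfl⟩ := List.mem_map.mp h
    exact Or.inr ⟨D, hD, mem_support_of_mem_support_strictTransformIdeal hx', rfl⟩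
  · exact Or.inl (List.mem_singleton.mp h)

omit [IsLocallyNoetherian X] in
/-- The one-directional matching of the transformed boundaries. [folklore] -/
theorem exists_mem_transform_boundary_stalkIdeal_eq [IsLocallyNoetherian X'] {B₁ B₂ : List X.IdealSheafData}
    (hf : ∀ x, ∀ D₁ ∈ B₁, x ∈ D₁.support → ∃ D₂ ∈ B₂, x ∈ D₂.support ∧ stalkIdeal D₂ x = stalkIdeal D₁ x)
    {x' : X'} {D₁' : X'.IdealSheafData} (hD₁' : D₁' ∈ B₁.map (strictTransformIdeal π C) ++ [C.comap π])
    (hx' : x' ∈ D₁'.support) :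
    ∃ D₂' ∈ B₂.map (strictTransformIdeal π C) ++ [C.comap π], x' ∈ D₂'.support ∧
      stalkIdeal D₂' x' = stalkIdeal D₁' x' := by
  rcases mem_transform_boundary_cases hD₁' hx' with rfl | ⟨D₁, hD₁, hx₁, rfl⟩
  · exact ⟨C.comap π, List.mem_append_right _ (List.mem_singleton_self _), hx', rfl⟩
  · obtain ⟨D₂, hD₂, hx₂, h₂⟩ := hf _ D₁ hD₁ hx₁
    have hst := stalkIdeal_strictTransformIdeal_congr (π := π) (C := C) (x' := x') h₂
    refine ⟨strictTransformIdeal π C D₂, List.mem_append_left _ (List.mem_map.mpr ⟨D₂, hD₂, rfl⟩), ?_, hst⟩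
    rw [mem_support_iff_stalkIdeal_le, hst]
    exact (mem_support_iff_stalkIdeal_le _ _).mp hx'

/-- Stalk-injectivity of a transformed boundary. [folklore] -/
theorem stalkInjectiveAt_transform_boundary {B : List X.IdealSheafData} (hB : HasSNCWith B C)
    (hπ : IsBlowup π C) (hinj : ∀ x, StalkInjectiveAt B x) (x' : X') :
    StalkInjectiveAt (B.map (strictTransformIdeal π C) ++ [C.comap π]) x' := by
  haveI : IsProper π := hπ.isProper
  haveI : IsLocallyNoetherian X' := LocallyOfFiniteType.isLocallyNoetherian π
  intro D' hD' D'' hD'' hx' hx'' heq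
  rcases mem_transform_boundary_cases hD' hx' with rfl | ⟨D₁, hD₁, hx₁, rfl⟩
  · rcases mem_transform_boundary_cases hD'' hx'' with rfl | ⟨D₂, hD₂, hx₂, rfl⟩
    · rfl
    · exact absurd heq.symm (stalkIdeal_strictTransformIdeal_ne_stalkIdeal_comap hB hπ hD₂ hx' hx'')
  · rcases mem_transform_boundary_cases hD'' hx'' with rfl | ⟨D₂, hD₂, hx₂, rfl⟩
    · exact absurd heq (stalkIdeal_strictTransformIdeal_ne_stalkIdeal_comap hB hπ hD₁ hx'' hx')
    · have hst := stalkIdeal_eq_of_stalkIdeal_strictTransformIdeal_eq hB hπ hD₁ hD₂ hx' hx₂ heq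
      rw [hinj _ D₁ hD₁ D₂ hD₂ hx₁ hx₂ hst]

/-- **Equivalence of boundaries persists under a blow-up** along a centre having simple normal
crossings with them: the transformed boundaries (strict transforms of the members, followed by
the exceptional divisor — BGMW Def. 3.1.3 (4), Kollár Def. 3.25) are again equivalent.
[cite: BierstoneGrigorievMilmanWlodarczyk2011, Def. 3.1.3 (4)] [cite: Kollar2007, Def. 3.25] -/
theorem BoundaryEquiv.transform {B₁ B₂ : List X.IdealSheafData} (he : BoundaryEquiv B₁ B₂)
    (hB₁ : HasSNCWith B₁ C) (hπ : IsBlowup π C) :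
    BoundaryEquiv (B₁.map (strictTransformIdeal π C) ++ [C.comap π])
      (B₂.map (strictTransformIdeal π C) ++ [C.comap π]) := by
  haveI : IsProper π := hπ.isProper
  haveI : IsLocallyNoetherian X' := LocallyOfFiniteType.isLocallyNoetherian π
  have hB₂ : HasSNCWith B₂ C := hB₁.of_boundaryEquiv he
  intro x'
  refine ⟨fun D₁' hD₁' hx' => exists_mem_transform_boundary_stalkIdeal_eq (fun x => (he x).1) hD₁' hx',
    fun D₂' hD₂' hx' => exists_mem_transform_boundary_stalkIdeal_eq (fun x => (he x).2.1) hD₂' hx',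
    stalkInjectiveAt_transform_boundary hB₁ hπ (fun x => (he x).2.2.1) x',
    stalkInjectiveAt_transform_boundary hB₂ hπ (fun x => (he x).2.2.2) x'⟩

/-- The transform of a marked ideal along equivalent boundaries. [folklore] -/
theorem BoundaryEquiv.transform_boundary {I : X.IdealSheafData} {B₁ B₂ : List X.IdealSheafData} {μ : ℕ}
    (he : BoundaryEquiv B₁ B₂) (hB₁ : HasSNCWith B₁ C) (hπ : IsBlowup π C) :
    BoundaryEquiv ((⟨I, B₁, μ⟩ : MarkedIdeal X).transform π C).boundary
      ((⟨I, B₂, μ⟩ : MarkedIdeal X).transform π C).boundary := by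
  rw [MarkedIdeal.transform_boundary, MarkedIdeal.transform_boundary]
  exact he.transform hB₁ hπ

end Transform

/-! ## Multiple blow-ups and resolutions along equivalent boundaries -/

namespace CentreSeq

/-- **A multiple blow-up of `(X, 𝓘, B₁, μ)` is a multiple blow-up of `(X, 𝓘, B₂, μ)` for every
equivalent boundary `B₂`** (BGMW Def. 3.1.3 (1)–(2), (4), stage by stage: the supports do not
see the boundary, simple normal crossings transfer, and the transformed boundaries stay
equivalent). [cite: BierstoneGrigorievMilmanWlodarczyk2011, Def. 3.1.3] -/
theorem IsAdmissibleFor.of_boundaryEquiv : ∀ {X : Scheme.{u}} [IsLocallyNoetherian X] (s : CentreSeq X)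
    {I : X.IdealSheafData} {B₁ B₂ : List X.IdealSheafData} {μ : ℕ}, BoundaryEquiv B₁ B₂ →
      s.IsAdmissibleFor ⟨I, B₁, μ⟩ → s.IsAdmissibleFor ⟨I, B₂, μ⟩
  | _, _, nil _, _, _, _, _, _, _ => trivial
  | X, _, cons C rest, I, B₁, B₂, μ, he, h => by
    obtain ⟨hsupp, hsnc, hC, hrest⟩ := h
    haveI : IsLocallyNoetherian (blowup C) := isLocallyNoetherian_blowup C
    refine ⟨hsupp, hsnc.of_boundaryEquiv he, hC, ?_⟩
    have he' := BoundaryEquiv.transform_boundary (I := I) (μ := μ) he hsnc (blowup.isBlowup C)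
    exact IsAdmissibleFor.of_boundaryEquiv rest he' hrest

/-- **A resolution of `(X, 𝓘, B₁, μ)` is a resolution of `(X, 𝓘, B₂, μ)` for every equivalent
boundary `B₂`.** [cite: BierstoneGrigorievMilmanWlodarczyk2011, Def. 3.1.3] -/
theorem IsResolutionOf.of_boundaryEquiv {X : Scheme.{u}} [IsLocallyNoetherian X] (s : CentreSeq X)
    {I : X.IdealSheafData} {B₁ B₂ : List X.IdealSheafData} {μ : ℕ} (he : BoundaryEquiv B₁ B₂)
    (h : s.IsResolutionOf ⟨I, B₁, μ⟩) : s.IsResolutionOf ⟨I, B₂, μ⟩ :=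
  ⟨IsAdmissibleFor.of_boundaryEquiv s he h.1,
    (transformMarked_support_eq s (M := ⟨I, B₂, μ⟩) (N := ⟨I, B₁, μ⟩) rfl rfl).trans h.2⟩

/-- **Resolutions do not depend on the order of the boundary.** [cite: BierstoneGrigorievMilmanWlodarczyk2011, Def. 3.1.1] -/
theorem IsResolutionOf.of_perm {X : Scheme.{u}} [IsLocallyNoetherian X] (s : CentreSeq X)
    {I : X.IdealSheafData} {B₁ B₂ : List X.IdealSheafData} {μ : ℕ} (hp : B₁.Perm B₂)
    (hB₁ : HasSNC B₁) (h : s.IsResolutionOf ⟨I, B₁, μ⟩) : s.IsResolutionOf ⟨I, B₂, μ⟩ :=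
  h.of_boundaryEquiv s (boundaryEquiv_of_perm hp hB₁.injOn_stalkIdeal)

/-- **Resolutions do not see empty boundary members.** [cite: BierstoneGrigorievMilmanWlodarczyk2011, Def. 3.1.1] -/
theorem IsResolutionOf.filter_ne_top {X : Scheme.{u}} [IsLocallyNoetherian X] [DecidableEq X.IdealSheafData]
    (s : CentreSeq X) {I : X.IdealSheafData} {B : List X.IdealSheafData} {μ : ℕ} (hB : HasSNC B) :
    s.IsResolutionOf ⟨I, B, μ⟩ ↔ s.IsResolutionOf ⟨I, B.filter fun D => D ≠ ⊤, μ⟩ :=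
  ⟨fun h => h.of_boundaryEquiv s (boundaryEquiv_filter_ne_top hB.injOn_stalkIdeal),
    fun h => h.of_boundaryEquiv s (boundaryEquiv_filter_ne_top hB.injOn_stalkIdeal).symm⟩

/-- **Resolutions do not see repetitions in the boundary.** [cite: BierstoneGrigorievMilmanWlodarczyk2011, Def. 3.1.1] -/
theorem IsResolutionOf.dedup {X : Scheme.{u}} [IsLocallyNoetherian X] [DecidableEq X.IdealSheafData]
    (s : CentreSeq X) {I : X.IdealSheafData} {B : List X.IdealSheafData} {μ : ℕ} (hB : HasSNC B) :
    s.IsResolutionOf ⟨I, B, μ⟩ ↔ s.IsResolutionOf ⟨I, B.dedup, μ⟩ :=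
  ⟨fun h => h.of_boundaryEquiv s (boundaryEquiv_dedup hB.injOn_stalkIdeal),
    fun h => h.of_boundaryEquiv s (boundaryEquiv_dedup hB.injOn_stalkIdeal).symm⟩

end CentreSeq

end Literature.AlgebraicGeometry.Resolution
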